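import Mathlib
import Summits.MatrixMultiplication.MatrixMultiplication.Theorems.LevelGradedCohnUmansLevelOneGL2DesignsTangencyParabolaLift
import Summits.MatrixMultiplication.MatrixMultiplication.Theorems.LevelGradedCohnUmansLevelOneGL2DesignsStubTangencySetsHermitianCircles

/-!
# Stub `stub_tangencySets` (crux `LevelOneGL2Designs`, stmt-MatrixMultiplication-14080) —
wall-breaker axis 1/12 "Hermitian unital constructions", part 3: the dichotomy and the
classification of `U₁`-invariant tangency sets of `AG(2,p)`

Continuation of `…StubTangencySetsHermitianCircles.lean` (part 2), which proved that inside the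
unitary family `P_A = {v : N(v) ∈ A}` (`N(x,y) = x² − n y²`, `n` a non-square of `𝔽_p`) the tangency
property is equivalent to the *character-clique* condition "`a(a − a')` is a square for all
`a, a' ∈ A`" (`circleUnion_srs`, `isSquare_of_privateLine`).  Here:

* `charClique_card_le_two`: if `−1` is a non-square (`p ≡ 3 mod 4`) a character clique has at most
  TWO elements (`χ(aa') = χ(−1)` for distinct members);
* `exists_coclique_card_eq_of_charClique`: if `−1` is a square (`p ≡ 1 mod 4`) a character clique
  is a Paley clique inside the squares or a Paley coclique inside the non-squares — in either case
  there is a Paley coclique of the same size;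
* `card_unitaryInvariant_tangencySet_le` (**classification**): an affine tangency set `V ⊆ 𝔽_p²`
  invariant under the unitary group `U₁ = {ρ_{c,s} : c² − n s² = 1}` is `{0} ∪ P_A` for a character
  clique `A` (transitivity of `U₁` on circles + rigidity), hence `|V| ≤ 2(p+1) + 1` for
  `p ≡ 3 (mod 4)` and `|V| ≤ (p+1)·|I| + 1` with `I` a Paley coclique for `p ≡ 1 (mod 4)`;
  `card_unitaryInvariant_tangencySet_le_sqrt`: so `|V| ≤ (p+1)·m + 1` with `m² ≤ p`
  (`ParabolaLift.card_coclique_sq_le`, axis 11).  A character clique inside the squares together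
  with `0` is a Paley clique, so for `p ≡ 1 (mod 4)` the bound reads `|V| ≤ (p+1)(ω(P_p) − 1) + 1`,
  `ω(P_p)` the Paley clique number, while `circleUnion_srs` + `circleUnion_invariant` (part 2)
  give `U₁`-invariant tangency sets with `(p+1)(ω(P_p) − 1)` points: sharp up to the origin.

Reading for the stub: the prime-field Hermitian structure (norm form + unitary group, the avatar of
the unital's `PGU`-symmetry) produces `c·p^{3/2}` flags iff Paley cliques of size `≥ c√p` exist for
unboundedly many `p ≡ 1 (mod 4)` — the residual already isolated by the parabola pencils
(`ParabolaLift.tangencySets_of_large_cocliques`, `TangencyRandAlg.tangencySets_of_paleyCocliques`)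
and registered independently for norm pencils by axis 10 (`NormPencil.stub_tangencySets_of_normCliques`);
and it is PROVABLY dead for `p ≡ 3 (mod 4)` (`≤ 2p + 3` points).  Elementary; no new definitions.
-/

set_option linter.dupNamespace false

namespace Summit.MatrixMultiplication.MatrixMultiplication.Theorems.LevelOneGL2Designs.HermitianUnital

open Finset Matrix

variable {p : ℕ} [hp : Fact p.Prime]


section Dichotomy

/-- **Character cliques, `p ≡ 3 (mod 4)`: at most two circles.**  If `0 ∉ A` and `a(a − a')` is
a square for all `a, a' ∈ A`, and `−1` is a non-square, then `|A| ≤ 2`: for distinct `a, a'` the two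
conditions multiply to `χ(a a') = χ(−1) = −1`, and three elements would give
`χ((abc)²) = (−1)³`. [elementary] -/
theorem charClique_card_le_two (A : Finset (ZMod p)) (hA0 : (0 : ZMod p) ∉ A)
    (hA : ∀ a ∈ A, ∀ a' ∈ A, IsSquare (a * (a - a'))) (hm1 : ¬ IsSquare (-1 : ZMod p)) :
    A.card ≤ 2 := by
  classical
  have hm : quadraticChar (ZMod p) (-1) = -1 := quadraticChar_neg_one_iff_not_isSquare.mpr hm1
  have key : ∀ a ∈ A, ∀ a' ∈ A, a ≠ a' → quadraticChar (ZMod p) (a * a') = -1 := by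
    intro a ha a' ha' hne
    have ha0 : a ≠ 0 := fun h => hA0 (h ▸ ha)
    have ha0' : a' ≠ 0 := fun h => hA0 (h ▸ ha')
    have hsub : a - a' ≠ 0 := sub_ne_zero.mpr hne
    have hsub' : a' - a ≠ 0 := sub_ne_zero.mpr hne.symm
    have h1 : quadraticChar (ZMod p) (a * (a - a')) = 1 :=
      (quadraticChar_one_iff_isSquare (mul_ne_zero ha0 hsub)).mpr (hA a ha a' ha')
    have h2 : quadraticChar (ZMod p) (a' * (a' - a)) = 1 :=
      (quadraticChar_one_iff_isSquare (mul_ne_zero ha0' hsub')).mpr (hA a' ha' a ha)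
    have hprod : quadraticChar (ZMod p) (a * (a - a')) * quadraticChar (ZMod p) (a' * (a' - a)) =
        quadraticChar (ZMod p) (a * a') * quadraticChar (ZMod p) (-1) *
          quadraticChar (ZMod p) ((a - a') ^ 2) := by
      rw [← map_mul, ← map_mul, ← map_mul]
      congr 1
      ring
    rw [h1, h2, hm, quadraticChar_sq_one' hsub] at hprod
    linarith
  by_contra hcard
  rw [not_le, Finset.two_lt_card] at hcard
  obtain ⟨a, ha, b, hb, c, hc, hab, hac, hbc⟩ := hcard
  have habc : a * b * c ≠ 0 := by
    refine mul_ne_zero (mul_ne_zero ?_ ?_) ?_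
    · exact fun h => hA0 (h ▸ ha)
    · exact fun h => hA0 (h ▸ hb)
    · exact fun h => hA0 (h ▸ hc)
  have e : quadraticChar (ZMod p) (a * b) * quadraticChar (ZMod p) (b * c) *
      quadraticChar (ZMod p) (a * c) = quadraticChar (ZMod p) ((a * b * c) ^ 2) := by
    rw [← map_mul, ← map_mul]
    congr 1
    ring
  rw [key a ha b hb hab, key b hb c hc hbc, key a ha c hc hac, quadraticChar_sq_one' habc] at e
  norm_num at e

/-- **Character cliques, `p ≡ 1 (mod 4)`: Paley cliques in one character class.**  If `0 ∉ A`,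
`a(a − a')` is a square for all `a, a' ∈ A`, and `−1` is a square, then all elements of `A` have the
same quadratic character `ε` and `χ(a − a') = ε` for distinct `a, a' ∈ A`: `A` is a Paley clique
inside the squares or a Paley coclique inside the non-squares.  We record the consequence used
below: there is a Paley COCLIQUE `I` (pairwise differences non-squares) with `|I| = |A|`
(`I = A`, or `I = ν·A` for a non-square `ν`). [elementary] -/
theorem exists_coclique_card_eq_of_charClique (A : Finset (ZMod p)) (hA0 : (0 : ZMod p) ∉ A)
    (hA : ∀ a ∈ A, ∀ a' ∈ A, IsSquare (a * (a - a'))) (hm1 : IsSquare (-1 : ZMod p)) :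
    ∃ I : Finset (ZMod p), I.card = A.card ∧ ∀ x ∈ I, ∀ y ∈ I, x ≠ y → ¬ IsSquare (x - y) := by
  classical
  by_cases hF : ringChar (ZMod p) = 2
  · -- `p = 2`: `A ⊆ {1}`
    refine ⟨A, rfl, fun x hx y hy hxy => ?_⟩
    exfalso
    have hp2 : p = 2 := by rwa [ZMod.ringChar_zmod_n] at hF
    have hsub : A ⊆ (univ : Finset (ZMod p)).erase 0 :=
      fun a ha => mem_erase.mpr ⟨fun h => hA0 (h ▸ ha), mem_univ a⟩
    have hcard : A.card ≤ 1 := by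
      have h := card_le_card hsub
      rw [card_erase_of_mem (mem_univ _), card_univ, ZMod.card] at h
      omega
    have h2 : 1 < A.card := Finset.one_lt_card.mpr ⟨x, hx, y, hy, hxy⟩
    omega
  rcases A.eq_empty_or_nonempty with rfl | ⟨a₀, ha₀⟩
  · exact ⟨∅, rfl, by simp⟩
  -- same character and clique/coclique property
  have key : ∀ a ∈ A, ∀ a' ∈ A, a ≠ a' →
      quadraticChar (ZMod p) a = quadraticChar (ZMod p) a' ∧
        quadraticChar (ZMod p) (a - a') = quadraticChar (ZMod p) a := by
    intro a ha a' ha' hne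
    have ha0 : a ≠ 0 := fun h => hA0 (h ▸ ha)
    have ha0' : a' ≠ 0 := fun h => hA0 (h ▸ ha')
    have hsub : a - a' ≠ 0 := sub_ne_zero.mpr hne
    have hsub' : a' - a ≠ 0 := sub_ne_zero.mpr hne.symm
    have h1 : quadraticChar (ZMod p) a * quadraticChar (ZMod p) (a - a') = 1 := by
      rw [← map_mul]
      exact (quadraticChar_one_iff_isSquare (mul_ne_zero ha0 hsub)).mpr (hA a ha a' ha')
    have h2 : quadraticChar (ZMod p) a' * quadraticChar (ZMod p) (a' - a) = 1 := by
      rw [← map_mul]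
      exact (quadraticChar_one_iff_isSquare (mul_ne_zero ha0' hsub')).mpr (hA a' ha' a ha)
    have hm : quadraticChar (ZMod p) (-1) = 1 :=
      (quadraticChar_one_iff_isSquare (neg_ne_zero.mpr one_ne_zero)).mpr hm1
    have hneg : quadraticChar (ZMod p) (a' - a) = quadraticChar (ZMod p) (a - a') := by
      rw [show a' - a = -1 * (a - a') by ring, map_mul, hm, one_mul]
    rw [hneg] at h2
    have hd : quadraticChar (ZMod p) (a - a') ^ 2 = 1 := quadraticChar_sq_one hsub
    have ea : quadraticChar (ZMod p) a = quadraticChar (ZMod p) (a - a') := by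
      calc quadraticChar (ZMod p) a
          = quadraticChar (ZMod p) a * quadraticChar (ZMod p) (a - a') ^ 2 := by rw [hd, mul_one]
        _ = (quadraticChar (ZMod p) a * quadraticChar (ZMod p) (a - a')) *
              quadraticChar (ZMod p) (a - a') := by ring
        _ = quadraticChar (ZMod p) (a - a') := by rw [h1, one_mul]
    have ea' : quadraticChar (ZMod p) a' = quadraticChar (ZMod p) (a - a') := by
      calc quadraticChar (ZMod p) a'
          = quadraticChar (ZMod p) a' * quadraticChar (ZMod p) (a - a') ^ 2 := by rw [hd, mul_one]
        _ = (quadraticChar (ZMod p) a' * quadraticChar (ZMod p) (a - a')) *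
              quadraticChar (ZMod p) (a - a') := by ring
        _ = quadraticChar (ZMod p) (a - a') := by rw [h2, one_mul]
    exact ⟨ea.trans ea'.symm, ea.symm⟩
  have ha₀0 : a₀ ≠ 0 := fun h => hA0 (h ▸ ha₀)
  rcases quadraticChar_dichotomy ha₀0 with hε | hε
  · -- all of `A` are squares, pairwise differences squares: multiply by a non-square
    obtain ⟨ν, hν⟩ := FiniteField.exists_nonsquare hF
    have hν0 : ν ≠ 0 := fun h => hν (h ▸ IsSquare.zero)
    have hχν : quadraticChar (ZMod p) ν = -1 := quadraticChar_neg_one_iff_not_isSquare.mpr hν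
    refine ⟨A.image (ν * ·), card_image_of_injective _ (mul_right_injective₀ hν0), ?_⟩
    simp only [mem_image]
    rintro _ ⟨x, hx, rfl⟩ _ ⟨y, hy, rfl⟩ hne
    have hxy : x ≠ y := fun h => hne (by rw [h])
    have hχx : quadraticChar (ZMod p) x = 1 := by
      by_cases hx₀ : x = a₀
      · rw [hx₀, hε]
      · rw [← (key a₀ ha₀ x hx (Ne.symm hx₀)).1, hε]
    have hχd : quadraticChar (ZMod p) (x - y) = 1 := by rw [(key x hx y hy hxy).2, hχx]
    rw [← mul_sub]
    apply quadraticChar_neg_one_iff_not_isSquare.mp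
    rw [map_mul, hχν, hχd]
    norm_num
  · -- all of `A` are non-squares, pairwise differences non-squares
    refine ⟨A, rfl, fun x hx y hy hxy => ?_⟩
    have hχx : quadraticChar (ZMod p) x = -1 := by
      by_cases hx₀ : x = a₀
      · rw [hx₀, hε]
      · rw [← (key a₀ ha₀ x hx (Ne.symm hx₀)).1, hε]
    apply quadraticChar_neg_one_iff_not_isSquare.mp
    rw [(key x hx y hy hxy).2, hχx]

end Dichotomy

/-! ## U₁-invariant tangency sets -/

section Invariant

variable {n : ZMod p}

/-- **Transitivity of `U₁` on each circle.**  If `N(v) = N(w) ≠ 0` then some rotation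
`ρ_{c,s}` (`c² − n s² = 1`) maps `v` to `w` (namely `c + s√n = w/v` in `𝔽_p(√n)`).
[elementary] -/
theorem exists_rotation_of_norm_eq (hn : ¬ IsSquare n) {v w : Fin 2 → ZMod p}
    (hv0 : v 0 ^ 2 - n * v 1 ^ 2 ≠ 0) (hvw : w 0 ^ 2 - n * w 1 ^ 2 = v 0 ^ 2 - n * v 1 ^ 2) :
    ∃ c s : ZMod p, c ^ 2 - n * s ^ 2 = 1 ∧ ![c * v 0 + n * s * v 1, s * v 0 + c * v 1] = w := by
  have _ := hn
  obtain ⟨a, ha⟩ : ∃ a, v 0 ^ 2 - n * v 1 ^ 2 = a := ⟨_, rfl⟩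
  rw [ha] at hv0 hvw
  refine ⟨(v 0 * w 0 - n * v 1 * w 1) / a, (v 0 * w 1 - v 1 * w 0) / a, ?_, ?_⟩
  · have hBr := norm_mul_norm n (v 0) (v 1) (w 0) (w 1)
    rw [ha, hvw] at hBr
    field_simp
    linear_combination -hBr
  · funext i
    fin_cases i
    · simp only [Fin.zero_eta, Fin.isValue, cons_val_zero]
      field_simp
      linear_combination w 0 * ha
    · simp only [Fin.mk_one, Fin.isValue, cons_val_one, cons_val_zero]
      field_simp
      linear_combination w 1 * ha

/-- **`U₁`-invariant tangency sets of `AG(2,p)` are governed by Paley cliques.**  Let `n` be a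
non-square and `V ⊆ 𝔽_p²` an affine tangency set (every `v ∈ V` has a line through it meeting `V`
only in `v`) that is invariant under the unitary group `U₁ = {ρ_{c,s} : c² − n s² = 1}` of the
norm form.  Then `V ∖ {0}` is a union of norm circles over a character clique `A`
(`isSquare_of_privateLine`), so:
* if `−1` is a non-square (`p ≡ 3 mod 4`): `|V| ≤ 2(p+1) + 1`;
* if `−1` is a square (`p ≡ 1 mod 4`): `|V| ≤ (p+1)·|I| + 1` for some Paley coclique `I ⊆ 𝔽_p`.
This is the dead-axis theorem of the unitary family: a near-extremal (`c·p^{3/2}`) tangency set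
with the symmetry of the prime-field Hermitian structure exists only if Paley cliques of size
`≥ c√p − 1` do. [elementary] -/
theorem card_unitaryInvariant_tangencySet_le (hn : ¬ IsSquare n) (V : Finset (Fin 2 → ZMod p))
    (hinv : ∀ v ∈ V, ∀ c s : ZMod p, c ^ 2 - n * s ^ 2 = 1 →
      ![c * v 0 + n * s * v 1, s * v 0 + c * v 1] ∈ V)
    (htan : ∀ v ∈ V, ∃ u : Fin 2 → ZMod p, u ≠ 0 ∧ ∀ w ∈ V, u ⬝ᵥ w = u ⬝ᵥ v → w = v) :
    (¬ IsSquare (-1 : ZMod p) → V.card ≤ 2 * (p + 1) + 1) ∧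
    (IsSquare (-1 : ZMod p) →
      ∃ I : Finset (ZMod p), (∀ x ∈ I, ∀ y ∈ I, x ≠ y → ¬ IsSquare (x - y)) ∧
        V.card ≤ (p + 1) * I.card + 1) := by
  classical
  -- the set of norms of the nonzero points of `V`
  set A : Finset (ZMod p) := (V.filter fun v => v ≠ 0).image
    fun v => v 0 ^ 2 - n * v 1 ^ 2 with hAdef
  have hA0 : (0 : ZMod p) ∉ A := by
    rw [hAdef, mem_image]
    rintro ⟨v, hv, hv0⟩
    rw [mem_filter] at hv
    obtain ⟨h0, h1⟩ := (norm_eq_zero_iff hn (v 0) (v 1)).mp hv0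
    apply hv.2
    funext i
    fin_cases i
    · exact h0
    · exact h1
  -- `V ∖ {0} = P_A`
  have hPV : ∀ w : Fin 2 → ZMod p, w 0 ^ 2 - n * w 1 ^ 2 ∈ A → w ∈ V := by
    intro w hw
    rw [hAdef, mem_image] at hw
    obtain ⟨v, hv, hvw⟩ := hw
    rw [mem_filter] at hv
    have hv0 : v 0 ^ 2 - n * v 1 ^ 2 ≠ 0 := by
      intro h
      obtain ⟨h0, h1⟩ := (norm_eq_zero_iff hn (v 0) (v 1)).mp h
      exact hv.2 (by funext i; fin_cases i <;> assumption)
    obtain ⟨c, s, hcs, hρ⟩ := exists_rotation_of_norm_eq hn hv0 hvw.symm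
    rw [← hρ]
    exact hinv v hv.1 c s hcs
  have hVP : ∀ v ∈ V, v ≠ 0 → v 0 ^ 2 - n * v 1 ^ 2 ∈ A := by
    intro v hv hv0
    rw [hAdef, mem_image]
    exact ⟨v, by rw [mem_filter]; exact ⟨hv, hv0⟩, rfl⟩
  -- the character-clique condition, by rigidity
  have hA : ∀ a ∈ A, ∀ a' ∈ A, IsSquare (a * (a - a')) := by
    intro a ha a' ha'
    have ha2 := ha
    rw [hAdef, mem_image] at ha2
    obtain ⟨v, hv, rfl⟩ := ha2
    rw [mem_filter] at hv
    refine isSquare_of_privateLine hn A hA0 ha ?_ ha'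
    obtain ⟨u, hu0, hu⟩ := htan v hv.1
    exact ⟨u, hu0, fun w hw huw => hu w (hPV w hw) huw⟩
  -- counting: `|V| ≤ |P_A| + 1 = (p+1)|A| + 1`
  have hcount : V.card ≤ (p + 1) * A.card + 1 := by
    have hsub : V.filter (fun v => v ≠ 0) ⊆
        univ.filter fun v : Fin 2 → ZMod p => v 0 ^ 2 - n * v 1 ^ 2 ∈ A := by
      intro v hv
      rw [mem_filter] at hv
      simpa using hVP v hv.1 hv.2
    have h1 : (V.filter fun v => v ≠ 0).card ≤ (p + 1) * A.card := by
      rw [← card_circleUnion hn A hA0]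
      exact card_le_card hsub
    have h2 : V.card ≤ (V.filter fun v => v ≠ 0).card + 1 := by
      calc V.card = (V.filter fun v => v ≠ 0).card + (V.filter fun v => ¬ v ≠ 0).card :=
            (card_filter_add_card_filter_not _).symm
        _ ≤ (V.filter fun v => v ≠ 0).card + 1 := by
            gcongr
            refine card_le_one.mpr ?_
            intro x hx y hy
            simp only [ne_eq, not_not, mem_filter] at hx hy
            rw [hx.2, hy.2]
    omega
  constructor
  · intro hm1
    have := charClique_card_le_two A hA0 hA hm1
    nlinarith
  · intro hm1
    obtain ⟨I, hI, hcoc⟩ := exists_coclique_card_eq_of_charClique A hA0 hA hm1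
    exact ⟨I, hcoc, by rw [hI]; exact hcount⟩

/-- **Corollary (the `(p+1)√p + 1` ceiling).**  Under the hypotheses of
`card_unitaryInvariant_tangencySet_le`, if `−1` is a square then `|V| ≤ (p+1)·m + 1` for some
`m` with `m² ≤ p` (Paley cocliques have `|I|² ≤ p`, `ParabolaLift.card_coclique_sq_le`); in
particular no `U₁`-invariant tangency set exceeds `p^{3/2} + p^{1/2} + 1`, and one of size
`c·p^{3/2}` forces a Paley coclique of size `≥ (c·p^{3/2} − 1)/(p+1)`. [elementary] -/
theorem card_unitaryInvariant_tangencySet_le_sqrt (hn : ¬ IsSquare n)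
    (V : Finset (Fin 2 → ZMod p))
    (hinv : ∀ v ∈ V, ∀ c s : ZMod p, c ^ 2 - n * s ^ 2 = 1 →
      ![c * v 0 + n * s * v 1, s * v 0 + c * v 1] ∈ V)
    (htan : ∀ v ∈ V, ∃ u : Fin 2 → ZMod p, u ≠ 0 ∧ ∀ w ∈ V, u ⬝ᵥ w = u ⬝ᵥ v → w = v)
    (hm1 : IsSquare (-1 : ZMod p)) :
    ∃ m : ℕ, m * m ≤ p ∧ V.card ≤ (p + 1) * m + 1 := by
  obtain ⟨I, hcoc, hle⟩ := (card_unitaryInvariant_tangencySet_le hn V hinv htan).2 hm1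
  exact ⟨I.card, ParabolaLift.card_coclique_sq_le I hcoc, hle⟩

/-- **Sharpness: circle unions over character cliques are `U₁`-invariant tangency sets.**  For a
character clique `A ⊆ 𝔽_p ∖ {0}`, every point `v` of `P_A = {w : N(w) ∈ A}` has a private line in
`P_A`, namely the tangent `v₀ X − n v₁ Y = N(v)` of its circle (the computation of
`circleUnion_srs`, in the affine format of `card_unitaryInvariant_tangencySet_le`); with
`circleUnion_invariant` and `card_circleUnion` this realises the bound `(p+1)·|A|` of the
classification for every character clique. [elementary] -/
theorem circleUnion_privateLine (hn : ¬ IsSquare n) (A : Finset (ZMod p)) (hA0 : (0 : ZMod p) ∉ A)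
    (hA : ∀ a ∈ A, ∀ a' ∈ A, IsSquare (a * (a - a'))) {v : Fin 2 → ZMod p}
    (hv : v 0 ^ 2 - n * v 1 ^ 2 ∈ A) :
    ∃ u : Fin 2 → ZMod p, u ≠ 0 ∧ ∀ w : Fin 2 → ZMod p, w 0 ^ 2 - n * w 1 ^ 2 ∈ A →
      u ⬝ᵥ w = u ⬝ᵥ v → w = v := by
  obtain ⟨a, ha⟩ : ∃ a, v 0 ^ 2 - n * v 1 ^ 2 = a := ⟨_, rfl⟩
  rw [ha] at hv
  have ha0 : a ≠ 0 := fun h => hA0 (h ▸ hv)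
  refine ⟨![v 0, -(n * v 1)], ?_, ?_⟩
  · intro hu
    have e0 : v 0 = 0 := by simpa using congrFun hu 0
    have e1 : n * v 1 = 0 := by simpa using congrFun hu 1
    apply ha0
    rw [← ha, e0]
    linear_combination -(v 1) * e1
  · intro w hw h
    obtain ⟨a', ha'⟩ : ∃ a', w 0 ^ 2 - n * w 1 ^ 2 = a' := ⟨_, rfl⟩
    rw [ha'] at hw
    simp only [vec2_dotProduct, cons_val_zero, cons_val_one] at h
    have hB : v 0 * w 0 - n * v 1 * w 1 = a := by linear_combination h + ha
    have hBr := norm_mul_norm n (v 0) (v 1) (w 0) (w 1)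
    rw [ha, ha', hB] at hBr
    have hs : v 0 * w 1 - v 1 * w 0 = 0 := by
      by_contra hs
      refine not_isSquare_mul_sq hn hs ?_
      have e : n * (v 0 * w 1 - v 1 * w 0) ^ 2 = a * (a - a') := by linear_combination hBr
      rw [e]
      exact hA a hv a' hw
    rw [hs] at hBr
    have haa : a' = a := by
      have e : a * (a' - a) = 0 := by linear_combination hBr
      rcases mul_eq_zero.mp e with e | e
      · exact absurd e ha0
      · linear_combination e
    have hN : (w 0 - v 0) ^ 2 - n * (w 1 - v 1) ^ 2 = 0 := by
      linear_combination ha' + ha - 2 * hB + haa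
    obtain ⟨h0, h1⟩ := (norm_eq_zero_iff hn _ _).mp hN
    funext i
    fin_cases i
    · exact sub_eq_zero.mp h0
    · exact sub_eq_zero.mp h1

/-- **The classification is sharp**: for every character clique `A ⊆ 𝔽_p ∖ {0}` the circle union
`P_A` is a `U₁`-invariant affine tangency set with exactly `(p+1)·|A|` points. [elementary] -/
theorem exists_unitaryInvariant_tangencySet (hn : ¬ IsSquare n) (A : Finset (ZMod p))
    (hA0 : (0 : ZMod p) ∉ A) (hA : ∀ a ∈ A, ∀ a' ∈ A, IsSquare (a * (a - a'))) :
    ∃ V : Finset (Fin 2 → ZMod p), V.card = (p + 1) * A.card ∧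
      (∀ v ∈ V, ∀ c s : ZMod p, c ^ 2 - n * s ^ 2 = 1 →
        ![c * v 0 + n * s * v 1, s * v 0 + c * v 1] ∈ V) ∧
      (∀ v ∈ V, ∃ u : Fin 2 → ZMod p, u ≠ 0 ∧ ∀ w ∈ V, u ⬝ᵥ w = u ⬝ᵥ v → w = v) := by
  classical
  refine ⟨univ.filter fun v : Fin 2 → ZMod p => v 0 ^ 2 - n * v 1 ^ 2 ∈ A,
    card_circleUnion hn A hA0, ?_, ?_⟩
  · intro v hv c s hcs
    simp only [mem_filter, mem_univ, true_and, cons_val_zero, cons_val_one] at hv ⊢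
    exact circleUnion_invariant A hv hcs
  · intro v hv
    simp only [mem_filter, mem_univ, true_and] at hv
    obtain ⟨u, hu0, hu⟩ := circleUnion_privateLine hn A hA0 hA hv
    exact ⟨u, hu0, fun w hw => hu w (by simpa using hw)⟩

end Invariant

end Summit.MatrixMultiplication.MatrixMultiplication.Theorems.LevelOneGL2Designs.HermitianUnital
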